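import Mathlib
import Summits.Ventures.PercRepro2.Defs
import Summits.Ventures.PercRepro2.Graph
import Summits.Ventures.PercRepro2.OneColourSwitch
import Summits.Ventures.PercRepro2.RegionHubSign
import Summits.Ventures.PercRepro2.SideSwitch
import Summits.Ventures.PercRepro2.TermSwitchDefs
import Summits.Ventures.PercRepro2.M9NoPocketDefs
import Summits.Ventures.PercRepro2.M9PsiOneDefs
import Summits.Ventures.PercRepro2.M9PsiOneWorlds
import Summits.Ventures.PercRepro2.M9PsiOneWorldsM
import Summits.Ventures.PercRepro2.M9PsiOneSurvive

/-!
# `Ψ₁` keeps the `Y`-link of `r, s` and kills their `W`-link (blind cell PercRepro2, p3 g31,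
2026-08-28; `proofs/P3-PAYMENT.md` §2, claim (ii))

The LAST-EDGE lemma (`exists_last_edge`): a connection `a ~ v` has a last edge `x–v` whose
other end is reached from `a` with every edge at `v` closed (`avoidAt`).  For `r ~_Y s` in `ω`
the last edge comes from the `Y`-core: from a joined-or-linking vertex (then the `Y`-path to it
survives in `Ψ₁ ω` — `conn_psiOne_r_of_conn_avoid` — and the last edge is kept), or from `Fnl`
— impossible, because the path to it avoiding `s` stays inside its block (`rooted_of_conn_avoid`)
and the last edge would make the block linking.  So `r ~_Y s` in `Ψ₁ ω` (`conn_psiOne_rs`).  A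
`W`-path `r → s` of `Ψ₁ ω` would end with an edge from `Fnl` whose block is then linking in `ω`
(`not_conn_compl_psiOne_rs`).  Hence `σ_rs(Ψ₁ ω) = 1` whenever `r ~_Y s` in `ω`
(`sigma_rs_psiOne`).  Own work; std axioms.
-/

namespace Summit.Ventures.PercRepro2

namespace NoPocket

open Finset Classical RegionHub OneColourSwitch SideSwitch TermSwitch

variable {V : Type*} {E : Type*}

section LastEdge

variable {ends : E → Sym2 V}

/-- The configuration `ω` with every edge at `v` closed. -/
noncomputable def avoidAt (ends : E → Sym2 V) (ω : Config E) (v : V) : Config E :=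
  fun e => if v ∈ ends e then false else ω e

/-- An open edge of `avoidAt ω v` is an open edge of `ω` not at `v`. -/
lemma avoidAt_eq_true {ω : Config E} {v : V} {e : E} (he : avoidAt ends ω v e = true) :
    v ∉ ends e ∧ ω e = true := by
  unfold avoidAt at he
  by_cases hv : v ∈ ends e
  · rw [if_pos hv] at he; exact absurd he Bool.false_ne_true
  · rw [if_neg hv] at he; exact ⟨hv, he⟩

/-- An open edge of `ω` not at `v` is open in `avoidAt ω v`. -/
lemma avoidAt_eq_true_of {ω : Config E} {v : V} {e : E} (hv : v ∉ ends e) (he : ω e = true) :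
    avoidAt ends ω v e = true := by
  unfold avoidAt; rw [if_neg hv]; exact he

/-- Nothing but `v` itself is connected to `v` once every edge at `v` is closed. -/
lemma ne_of_conn_avoidAt {ω : Config E} {v a b : V} (hav : a ≠ v)
    (hc : Conn ends (avoidAt ends ω v) a b) : b ≠ v := by
  have key : b ∈ {x | x ≠ v} := by
    refine mem_of_conn_of_closed (ends := ends) (ω := avoidAt ends ω v) ?_ hav hc
    intro x _ y hxy
    obtain ⟨_, e, he, hends⟩ := openGraph_adj.1 hxy
    intro hyv
    exact (avoidAt_eq_true he).1 (by rw [hends, hyv]; exact Sym2.mem_mk_right _ _)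
  exact key

/-- **The last edge of a connection**: if `a ~ v` in `ω` with `a ≠ v`, some open edge `x–v`
has `x` reached from `a` with every edge at `v` closed. -/
lemma exists_last_edge {ω : Config E} {a v : V} (hav : a ≠ v) (hc : Conn ends ω a v) :
    ∃ x e, Conn ends (avoidAt ends ω v) a x ∧ ω e = true ∧ ends e = s(x, v) := by
  by_contra hcon
  have hcon' : ∀ x e, Conn ends (avoidAt ends ω v) a x → ω e = true → ends e = s(x, v) → False :=
    fun x e h1 h2 h3 => hcon ⟨x, e, h1, h2, h3⟩
  have key : v ∈ {x | Conn ends (avoidAt ends ω v) a x} := by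
    refine mem_of_conn_of_closed (ends := ends) (ω := ω) ?_ (conn_refl _ _ _) hc
    intro x hx y hxy
    obtain ⟨hne, e, he, hends⟩ := openGraph_adj.1 hxy
    by_cases hyv : y = v
    · exact (hcon' x e hx he (hyv ▸ hends)).elim
    · have hxv : x ≠ v := ne_of_conn_avoidAt hav hx
      have hv : v ∉ ends e := by
        rw [hends, Sym2.mem_iff]
        rintro (rfl | rfl)
        · exact hxv rfl
        · exact hyv rfl
      exact conn_trans hx (conn_of_openAdj ⟨e, avoidAt_eq_true_of hv he, hends⟩)
  exact ne_of_conn_avoidAt hav key rfl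

end LastEdge

section Blocks

variable {ends : E → Sym2 V} {r s d : V} {ω : Config E}

/-- The joined `Y`-set is a union of blocks. -/
lemma mem_joinedY_of_conn {x y : V} (hx : x ∈ joinedY ends r s d ω)
    (hc : Conn ends (allIn ends (Kcore ends r s d ω)) x y) : y ∈ joinedY ends r s d ω := by
  obtain ⟨h₀, hh₀, hc₀⟩ := hx
  exact ⟨h₀, hh₀, conn_trans hc₀ hc⟩

/-- A block lies inside its set. -/
lemma blockIn_subset {S : Set V} {x : V} (hx : x ∈ S) : blockIn ends S x ⊆ S := by
  intro y hy
  exact expl_allIn_subset (H := {x}) (by simpa using hx) ⟨x, rfl, hy⟩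

/-- A vertex lies in its own block. -/
lemma mem_blockIn_self (S : Set V) (x : V) : x ∈ blockIn ends S x := conn_refl _ _ _

/-- The block of a vertex of `Fnl` lies in `Fnl`. -/
lemma blockIn_subset_Fnl {x : V} (hx : x ∈ Fnl ends r s d ω) :
    blockIn ends (Kcore ends r s d ω) x ⊆ Fnl ends r s d ω := by
  intro y hy
  have hyK : y ∈ Kcore ends r s d ω := blockIn_subset hx.1 hy
  refine ⟨hyK, ?_, ?_⟩
  · intro hyJ; exact hx.2.1 (mem_joinedY_of_conn hyJ (conn_symm hy))
  · rintro ⟨_, hc⟩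
    exact hx.2.2 ⟨hx.1, by rwa [blockIn_eq_of_conn hy]⟩

/-- An edge inside `S` is open in `restrictTo ω S` iff open in `ω`. -/
lemma restrictTo_eq {S : Set V} {x y : V} {e : E} (hx : x ∈ S) (hy : y ∈ S)
    (hends : ends e = s(x, y)) : restrictTo ends ω S e = ω e := by
  unfold restrictTo; rw [if_pos ⟨x, hx, y, hy, hends⟩]

/-- A core vertex adjacent to a block vertex (inside the core) lies in the block. -/
lemma mem_blockIn_of_edge {x y z : V} {e : E} (hy : y ∈ blockIn ends (Kcore ends r s d ω) x)
    (hz : z ∈ Kcore ends r s d ω) (hyK : y ∈ Kcore ends r s d ω) (hends : ends e = s(y, z)) :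
    z ∈ blockIn ends (Kcore ends r s d ω) x :=
  conn_trans hy (conn_allIn_of_edge hyK hz hends)

end Blocks

section Link

variable {ends : E → Sym2 V} {p q r s d : V} {ω : Config E}

variable (h : IsEX ends p q r s d ω)
include h

/-- The `r`-side survival set: `{y : r ~_Y y in Ψ₁ ω} ∪ Fnl ∪ Mcore ∪ Outside` is closed under
the open edges of `ω` not at `s`. -/
lemma rsurvive_closed :
    ∀ x ∈ {z | Conn ends (psiOne ends r s d ω) r z ∨ z ∈ Fnl ends r s d ω ∨
        z ∈ Mcore ends r s d ω ∨ z ∈ Outside ends r s ω},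
      ∀ y, (openGraph ends (avoidAt ends ω s)).Adj x y →
        y ∈ {z | Conn ends (psiOne ends r s d ω) r z ∨ z ∈ Fnl ends r s d ω ∨
          z ∈ Mcore ends r s d ω ∨ z ∈ Outside ends r s ω} := by
  intro x hx y hxy
  obtain ⟨hne, e, he₀, hends⟩ := openGraph_adj.1 hxy
  obtain ⟨hse, he⟩ := avoidAt_eq_true he₀
  simp only [Set.mem_setOf_eq] at hx ⊢
  have hx_conn : x ∉ Fnl ends r s d ω → x ∉ Mcore ends r s d ω → x ∉ Outside ends r s ω →
      Conn ends (psiOne ends r s d ω) r x := by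
    intro h1 h2 h3
    rcases hx with hx | hx | hx | hx
    · exact hx
    · exact (h1 hx).elim
    · exact (h2 hx).elim
    · exact (h3 hx).elim
  rcases vertex_cases (ends := ends) (r := r) (s := s) (d := d) (ω := ω) y with
    hy | hy | hy | hyK | hyM | hyO
  · exact Or.inl (hy ▸ conn_refl _ _ _)
  · exact (hse (by rw [hends, hy]; exact Sym2.mem_mk_right _ _)).elim
  · left
    rw [hy] at hends ⊢
    rcases vertex_cases (ends := ends) (r := r) (s := s) (d := d) (ω := ω) x with
      hx' | hx' | hx' | hxK | hxM | hxO
    · exact (no_edge_d_term h (Or.inl hx') (ends_swap hends)).elim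
    · exact (no_edge_d_term h (Or.inr hx') (ends_swap hends)).elim
    · exact (hne (hx'.trans hy.symm)).elim
    · have hxJ : x ∈ joinedY ends r s d ω := mem_joinedY_of_adj_d hxK hends
      have hxc := hx_conn (fun hF => hF.2.1 hxJ) (not_mem_Mcore_of_mem_Kcore h.done hxK)
        (fun hO => hO.1 hxK.1)
      have hk : e ∈ keptEdges ends r s d ω := mem_keptEdges_of_touches (Or.inl hxJ) hends
      exact conn_trans hxc (conn_of_openAdj ⟨e, by rw [psiOne_of_kept hk]; exact he, hends⟩)
    · rw [edge_Mcore_d h hxM hends] at he; exact (Bool.false_ne_true he).elim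
    · exact (no_edge_d_out h hxO (ends_swap hends)).elim
  · rcases Kcore_cases hyK with hyJ | hyF
    · left
      have hk : e ∈ keptEdges ends r s d ω := mem_keptEdges_of_touches hyJ (ends_swap hends)
      have he' : psiOne ends r s d ω e = true := by rw [psiOne_of_kept hk]; exact he
      rcases vertex_cases (ends := ends) (r := r) (s := s) (d := d) (ω := ω) x with
        hx' | hx' | hx' | hxK | hxM | hxO
      · rw [hx'] at hends; exact conn_of_openAdj ⟨e, he', hends⟩
      · exact (hse (by rw [hends, hx']; exact Sym2.mem_mk_left _ _)).elim
      · rw [hx'] at hends hx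
        have hdc := hx_conn (hx' ▸ fun hF => d_not_mem_Kcore hF.1) (hx' ▸ d_not_mem_Mcore)
          (hx' ▸ fun hO => hO.1 h.inK)
        rw [hx'] at hdc
        exact conn_trans hdc (conn_of_openAdj ⟨e, he', hends⟩)
      · have hxJ : x ∈ joinedY ends r s d ω ∪ linkSetY ends r s d ω :=
          mem_union_of_edge hyJ hxK (ends_swap hends)
        have hxc := hx_conn (fun hF => not_mem_union_of_mem_Fnl hF hxJ)
          (not_mem_Mcore_of_mem_Kcore h.done hxK) (fun hO => hO.1 hxK.1)
        exact conn_trans hxc (conn_of_openAdj ⟨e, he', hends⟩)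
      · exact (no_edge_core_core h hyK hxM (ends_swap hends)).elim
      · rw [edge_Kcore_out hyK hxO (ends_swap hends)] at he; exact (Bool.false_ne_true he).elim
    · exact Or.inr (Or.inl hyF)
  · exact Or.inr (Or.inr (Or.inl hyM))
  · exact Or.inr (Or.inr (Or.inr hyO))

/-- A joined-or-linking vertex reached from `r` in `ω` avoiding `s` is reached from `r` in
`Ψ₁ ω`. -/
lemma conn_psiOne_r_of_conn_avoid {x : V} (hx : x ∈ joinedY ends r s d ω ∪ linkSetY ends r s d ω)
    (hc : Conn ends (avoidAt ends ω s) r x) : Conn ends (psiOne ends r s d ω) r x := by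
  have hx' : x ∈ {z | Conn ends (psiOne ends r s d ω) r z ∨ z ∈ Fnl ends r s d ω ∨
      z ∈ Mcore ends r s d ω ∨ z ∈ Outside ends r s ω} :=
    mem_of_conn_of_closed (rsurvive_closed h) (Or.inl (conn_refl _ _ _)) hc
  rcases hx' with hx' | hx' | hx' | hx'
  · exact hx'
  · exact (not_mem_union_of_mem_Fnl hx' hx).elim
  · exact (not_mem_Mcore_of_mem_Kcore h.done (mem_Kcore_of_mem_union hx) hx').elim
  · exact (hx'.1 (mem_Kcore_of_mem_union hx).1).elim

/-- A vertex of `Fnl` reached from `r` in `ω` avoiding `s` is reached from `r` inside its block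
(with `r, s`). -/
lemma rooted_of_conn_avoid {x : V} (hx : x ∈ Fnl ends r s d ω)
    (hc : Conn ends (avoidAt ends ω s) r x) :
    Conn ends (restrictTo ends ω (blockIn ends (Kcore ends r s d ω) x ∪ {r, s})) r x := by
  set B := blockIn ends (Kcore ends r s d ω) x with hB
  have hBK : B ⊆ Kcore ends r s d ω := blockIn_subset hx.1
  have hBF : B ⊆ Fnl ends r s d ω := blockIn_subset_Fnl hx
  have hrB : r ∉ B := fun hr => term_not_mem_Kcore (Or.inl rfl) (hBK hr)
  have key : x ∈ {y | y ∉ B ∨ Conn ends (restrictTo ends ω (B ∪ {r, s})) r y} := by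
    refine mem_of_conn_of_closed (ends := ends) (ω := avoidAt ends ω s) ?_ (Or.inl hrB) hc
    intro y₁ hy₁ y₂ hy
    obtain ⟨hne, e, he₀, hends⟩ := openGraph_adj.1 hy
    obtain ⟨hse, he⟩ := avoidAt_eq_true he₀
    simp only [Set.mem_setOf_eq] at hy₁ ⊢
    by_cases hy₂B : y₂ ∈ B
    · right
      have hy₂K : y₂ ∈ Kcore ends r s d ω := hBK hy₂B
      rcases vertex_cases (ends := ends) (r := r) (s := s) (d := d) (ω := ω) y₁ with
        hy₁' | hy₁' | hy₁' | hy₁K | hy₁M | hy₁O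
      · rw [hy₁'] at hends
        exact conn_of_openAdj ⟨e, by rw [restrictTo_eq (S := B ∪ {r, s}) (by simp) (Or.inl hy₂B) hends]; exact he, hends⟩
      · exact (hse (by rw [hends, hy₁']; exact Sym2.mem_mk_left _ _)).elim
      · rw [hy₁'] at hends
        exact (hx.2.1 (mem_joinedY_of_conn (mem_joinedY_of_nbr hy₂K hends) (conn_symm hy₂B))).elim
      · have hy₁B : y₁ ∈ B := mem_blockIn_of_edge hy₂B hy₁K hy₂K (ends_swap hends)
        have hc₁ : Conn ends (restrictTo ends ω (B ∪ {r, s})) r y₁ := by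
          rcases hy₁ with hy₁ | hy₁
          · exact (hy₁ hy₁B).elim
          · exact hy₁
        exact conn_trans hc₁ (conn_of_openAdj ⟨e,
          by rw [restrictTo_eq (S := B ∪ {r, s}) (Or.inl hy₁B) (Or.inl hy₂B) hends]; exact he, hends⟩)
      · exact (no_edge_core_core h hy₂K hy₁M (ends_swap hends)).elim
      · rw [edge_Kcore_out hy₂K hy₁O (ends_swap hends)] at he; exact (Bool.false_ne_true he).elim
    · exact Or.inl hy₂B
  rcases key with key | key
  · exact (key (mem_blockIn_self _ _)).elim
  · exact key

/-- **`r ~_Y s` in `ω` gives `r ~_Y s` in `Ψ₁ ω`** (no `r–s` edge). -/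
theorem conn_psiOne_rs (hrs : ∀ e, ends e ≠ s(r, s)) (hc : Conn ends ω r s) :
    Conn ends (psiOne ends r s d ω) r s := by
  obtain ⟨x, e, hcx, he, hends⟩ := exists_last_edge h.hrs hc
  rcases vertex_cases (ends := ends) (r := r) (s := s) (d := d) (ω := ω) x with
    hx | hx | hx | hxK | hxM | hxO
  · exact (hrs e (hx ▸ hends)).elim
  · exact (ne_of_conn_avoidAt h.hrs hcx hx).elim
  · exact (no_edge_d_term h (Or.inr rfl) (hx ▸ hends)).elim
  · rcases Kcore_cases hxK with hxJ | hxF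
    · have hk : e ∈ keptEdges ends r s d ω := mem_keptEdges_of_touches hxJ hends
      exact conn_trans (conn_psiOne_r_of_conn_avoid h hxJ hcx)
        (conn_of_openAdj ⟨e, by rw [psiOne_of_kept hk]; exact he, hends⟩)
    · exfalso
      have hrx := rooted_of_conn_avoid h hxF hcx
      have hlink : Conn ends (restrictTo ends ω (blockIn ends (Kcore ends r s d ω) x ∪ {r, s})) r s :=
        conn_trans hrx (conn_of_openAdj ⟨e,
          by rw [restrictTo_eq (S := blockIn ends (Kcore ends r s d ω) x ∪ {r, s}) (Or.inl (mem_blockIn_self _ _)) (by simp) hends]; exact he, hends⟩)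
      exact hxF.2.2 ⟨hxK, hlink⟩
  · rw [edge_Mcore_term h hxM (Or.inr rfl) hends] at he; exact (Bool.false_ne_true he).elim
  · exact (no_edge_out_term h hxO (Or.inr rfl) (ends_swap hends)).elim

end Link

end NoPocket

end Summit.Ventures.PercRepro2
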